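import Literature.NumberTheory.Rogawski1990.EndoscopicSingularLocusNull                -- ★/this seat: the model level (`H = U(σ,J₂) × U(σ,J₁)`, `G`-singular set Haar-null)
import Literature.NumberTheory.Automorphic.UnitaryCartanRegularAE                      -- ★ p851336: scalar inputs `δ`, `ε_k` at `L_w`; the one-place transport idiom
import Literature.NumberTheory.Rogawski1990.LocalTransfer                              -- ★ `IsLocalGRegular`, `endoEmbLocal`
import HarnessLib

/-!
# F0 · P3c · crux H413 — (H2) «SINGULAR-NULL-H»: the `G`-singular set of `H_v = U(Φ₂)(L⁺_v) × U(Φ₁)(L⁺_v)` is Haar-null at every non-split place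
# [Rogawski1990, §4.3 p. 42, §12.5 pp. 182–183; HarishChandra1970, Lemma 42]

Cell `pub/hodgecm-mathlib`, crux H413 = `stmt-HodgeConjecture-24833` (lane `--supports …`, count-neutral), route HCCMUnconditional; seat F0P3a-p06 (g22), brick
(H2) of the «UP-TRANSFER» census (`F0/P3/F0P3-p02/g23/CENSUS-UPTR.v1.F0P3p02g23.md` §3; the `H_v`-side measure theory of [Rogawski1990, Lemma 12.5.1]).
THEOREMS ONLY (no definition ∕ instance ∕ notation ∕ named fact ∕ `sorry`); ★-only imports.  The H-twin of ★ (J8) `F0P3cStCharTSSingularNull` (the singular set of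
`G_v = U(Φ₃)(L⁺_v)` is Haar-null).

WHAT.  Every manipulation of `∫_{H_v} f^H · α` in the stabilised trace formula (the Weyl integration formula on `H_v`, the stable regrouping, the adjoint
transfer `α ↦ α^G` of [Rogawski1990, p. 183]) restricts to the `G`-REGULAR elements of `H_v` (★ `IsLocalGRegular L v`: the block image `ι_v(γ_H) ∈ U(Φ₃)(L⁺_v)`
is regular semisimple) and needs «the non-`G`-regular elements of `H_v` form a Haar-null set».  Here:
* `measure_setOf_not_isLocalGRegular_local_eq_zero` — at a place `w ∣ v` fixed by complex conjugation, for every Haar measure `ν` on the product carrier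
  `H_v = (cmDatum L 2 Φ₂).Local v × (cmDatum L 1 Φ₁).Local v` (any Borel structure on the product): `ν {s | ¬ IsLocalGRegular L v s} = 0`;
* `measure_setOf_not_isLocalGRegular_local_eq_zero_of_forall` — the same under the organ's binder `hns : ∀ w ∣ v, c • w = w`;
* `ae_isLocalGRegular` — the a.e. form.
ROAD.  ★ model theorem `Literature.NumberTheory.Rogawski1990.exists_closed_null_superset_GSingular` in `U(σ_w, (Φ₂)_w)(L_w) × U(σ_w, (Φ₁)_w)(L_w)` (a closed
superset of the `G`-singular locus, null for EVERY Haar measure; `(Φ₂)_w = antidiag(1,1)` is diagonalised by the rational frame `P = [[1,1],[1,−1]]`: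
`ᵗP (Φ₂)_w P = diag(2, −2)`), transported along the product of the one-place models ★ `localNonsplitEquiv` (`N = 2` and `N = 1`; Haar goes to Haar); the
predicate is read through ★ `isRegularElt_iff_charpoly_separable_localNonsplitEquiv` at `N = 3` and ★ `map_endoGL` (`ι_v(γ_H)_w = ι((γ_H.1)_w, (γ_H.2)_w)`).
HONEST LABEL.  Count-neutral helper: closes no organ (substrate of the `H_v`-side Weyl integration formula of road «UP-TR», not chartered at the time of
writing).  HC_CM is proved only modulo the 7 printed citations (2 remaining named inputs: hLiu418 = `stmt-HodgeConjecture-24832`, h413 = `stmt-HodgeConjecture-24833`)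
until rung 0 closes.

## References
* [Rogawski1990] J. D. Rogawski, *Automorphic Representations of Unitary Groups in Three Variables*, Ann. of Math. Stud. 123 (1990), §4.3 p. 42; §4.8 p. 53; §12.5 pp. 182–183.
* [HarishChandra1970] Harish-Chandra (notes by G. van Dijk), *Harmonic Analysis on Reductive p-adic Groups*, LNM 162 (1970), Lemma 42.
* [PlatonovRapinchuk1994] V. Platonov, A. Rapinchuk, *Algebraic Groups and Number Theory* (1994), §2.3, §5.1 (one-place model, congruent forms).
-/

set_option autoImplicit false
-- the mandated namespace has the single-problem summit's repeated segment (`HodgeConjecture.HodgeConjecture`)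
set_option linter.dupNamespace false

noncomputable section

open NumberField IsDedekindDomain MeasureTheory Filter Topology
open scoped Matrix MatrixGroups
open Literature.NumberTheory.Rogawski1990 Literature.NumberTheory.Automorphic Literature.NumberTheory.Automorphic.UnitaryGroup

namespace Summit.HodgeConjecture.HodgeConjecture.Cruxes.H413.F0P3cStCharTSSingularNullH

variable (L : Type) [Field L] [NumberField L] [IsCMField L]

section Frame

omit [IsCMField L] in
/-- **The rational frame diagonalising `Φ₂`**: over `L_w` (characteristic `0`) the matrix `P = [[1,1],[1,−1]]` (columns `e₁ + e₂`, `e₁ − e₂`) is invertible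
(`det P = −2`). [cite: Rogawski1990, §4.8 p. 53] -/
theorem det_quasiSplitFrameTwo (w : HeightOneSpectrum (𝓞 L)) :
    (!![(1 : w.adicCompletion L), 1; 1, -1] : Matrix (Fin 2) (Fin 2) (w.adicCompletion L)).det ≠ 0 := by
  haveI : CharZero (w.adicCompletion L) := charZero_of_injective_algebraMap (algebraMap L (w.adicCompletion L)).injective
  rw [Matrix.det_fin_two]
  simp
  norm_num

/-- **`ᵗσ_w(P)·(Φ₂)_w·P = diag(2, −2)`** for the rational frame `P = [[1,1],[1,−1]]` (entries `±1`, `σ_w`-fixed) and the local quasi-split form `(Φ₂)_w = antidiag(1,1)`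
at a place `w` fixed by complex conjugation. [cite: Rogawski1990, §4.8 p. 53] [cite: PlatonovRapinchuk1994, §2.3] -/
theorem formCongr_quasiSplitFrameTwo_eq_diagonal (w : HeightOneSpectrum (𝓞 L)) (hw : IsCMField.complexConj L • w = w) :
    formCongr (galAdicCompletionMap (L := L) (IsCMField.complexConj L) hw)
        (Matrix.GeneralLinearGroup.mkOfDetNeZero
          (!![(1 : w.adicCompletion L), 1; 1, -1] : Matrix (Fin 2) (Fin 2) (w.adicCompletion L)) (det_quasiSplitFrameTwo L w))
        (placeForm (Matrix.of fun i j : Fin 2 => if i.val + j.val + 1 = 2 then (1 : L) else 0) w) =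
      Matrix.diagonal ![2, -2] := by
  have hP : (!![(1 : w.adicCompletion L), 1; 1, -1] : Matrix (Fin 2) (Fin 2) (w.adicCompletion L)).map
      (galAdicCompletionMap (L := L) (IsCMField.complexConj L) hw) = !![(1 : w.adicCompletion L), 1; 1, -1] := by
    ext i j
    fin_cases i <;> fin_cases j <;> simp
  have hval : ((Matrix.GeneralLinearGroup.mkOfDetNeZero
      (!![(1 : w.adicCompletion L), 1; 1, -1] : Matrix (Fin 2) (Fin 2) (w.adicCompletion L)) (det_quasiSplitFrameTwo L w) :
        GL (Fin 2) (w.adicCompletion L)) : Matrix (Fin 2) (Fin 2) (w.adicCompletion L)) =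
      !![(1 : w.adicCompletion L), 1; 1, -1] := rfl
  have hform : placeForm (Matrix.of fun i j : Fin 2 => if i.val + j.val + 1 = 2 then (1 : L) else 0) w =
      (!![0, 1; 1, 0] : Matrix (Fin 2) (Fin 2) (w.adicCompletion L)) := by
    ext i j
    fin_cases i <;> fin_cases j <;> simp [placeForm, Matrix.map_apply]
  dsimp only [formCongr]
  rw [hval, hform, hP]
  ext i j
  fin_cases i <;> fin_cases j <;> norm_num [Matrix.mul_apply, Fin.sum_univ_two, Matrix.diagonal]

end Frame

section H

variable (v : HeightOneSpectrum (𝓞 ↥(maximalRealSubfield L)))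

/-- **(H2) «SINGULAR-NULL-H» — THE `G`-SINGULAR SET OF `H_v = U(Φ₂)(L⁺_v) × U(Φ₁)(L⁺_v)` IS HAAR-NULL** at a non-split place (`w ∣ v` fixed by complex conjugation):
for every Haar measure `ν` on `H_v` (any Borel structure on the product carrier), `ν {s | ¬ IsLocalGRegular L v s} = 0` — the non-`G`-regular `γ_H` (those whose block
image `ι_v(γ_H) ∈ U(Φ₃)(L⁺_v)` is not regular semisimple) are negligible; the input «`G`-regular a.e.» of the `H_v`-side Weyl integration formula and of the adjoint
transfer `α ↦ α^G`.  ★ `exists_closed_null_superset_GSingular` in the one-place model `U(σ_w, (Φ₂)_w)(L_w) × U(σ_w, (Φ₁)_w)(L_w)` with the frame `P = [[1,1],[1,−1]]`,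
transported along ★ `localNonsplitEquiv` (`N = 2, 1`); the predicate through ★ `isRegularElt_iff_charpoly_separable_localNonsplitEquiv` (`N = 3`) and ★ `map_endoGL`.
[cite: Rogawski1990, §4.3 p. 42; §12.5 pp. 182–183] [cite: HarishChandra1970, Lemma 42] -/
theorem measure_setOf_not_isLocalGRegular_local_eq_zero (w : PlacesOver L v) (hw : IsCMField.complexConj L • w.1 = w.1)
    [MeasurableSpace (((cmDatum L 2 (Matrix.of fun i j : Fin 2 => if i.val + j.val + 1 = 2 then (1 : L) else 0)).Local v ×
      (cmDatum L 1 (Matrix.of fun i j : Fin 1 => if i.val + j.val + 1 = 1 then (1 : L) else 0)).Local v))]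
    [BorelSpace (((cmDatum L 2 (Matrix.of fun i j : Fin 2 => if i.val + j.val + 1 = 2 then (1 : L) else 0)).Local v ×
      (cmDatum L 1 (Matrix.of fun i j : Fin 1 => if i.val + j.val + 1 = 1 then (1 : L) else 0)).Local v))]
    (ν : Measure (((cmDatum L 2 (Matrix.of fun i j : Fin 2 => if i.val + j.val + 1 = 2 then (1 : L) else 0)).Local v ×
      (cmDatum L 1 (Matrix.of fun i j : Fin 1 => if i.val + j.val + 1 = 1 then (1 : L) else 0)).Local v))) [ν.IsHaarMeasure] :
    ν {s | ¬ IsLocalGRegular L v s} = 0 := by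
  letI : MeasurableSpace (w.1.adicCompletion L) := borel _
  haveI : BorelSpace (w.1.adicCompletion L) := ⟨rfl⟩
  haveI : SecondCountableTopology (w.1.adicCompletion L) := secondCountableTopology_adicCompletion L w.1
  haveI : CharZero (w.1.adicCompletion L) := charZero_of_injective_algebraMap (algebraMap L (w.1.adicCompletion L)).injective
  have hc : IsCMField.complexConj L ≠ 1 := IsCMField.complexConj_ne_one L
  -- the scalar inputs at `L_w`
  have hσc : Continuous (galAdicCompletionMap (L := L) (IsCMField.complexConj L) hw) := continuous_galAdicCompletionMap L (IsCMField.complexConj L) hw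
  have hσσ : ∀ x, galAdicCompletionMap (L := L) (IsCMField.complexConj L) hw (galAdicCompletionMap (L := L) (IsCMField.complexConj L) hw x) = x :=
    galAdicCompletionMap_galAdicCompletionMap_of_smul_eq (IsCMField.complexConj L) w hc hw
  obtain ⟨δ, hσδ, hδ⟩ := exists_skew_ne_zero_adicCompletion (IsCMField.complexConj L) hc w hw
  have ha : galAdicCompletionMap (L := L) (IsCMField.complexConj L) hw δ ≠ δ := by
    rw [hσδ]
    intro hneg
    apply hδ
    have h2 : (2 : w.1.adicCompletion L) * δ = 0 := by linear_combination -hneg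
    exact (mul_eq_zero.mp h2).resolve_left two_ne_zero
  obtain ⟨ε, hε, hε0, hσε⟩ := exists_null_seq_fixed_adicCompletion (IsCMField.complexConj L) hc w hw
  -- the one-place models of the two factors, their product, and the transport
  letI : MeasurableSpace
      (↥(unitaryGroupOfForm (galAdicCompletionMap (L := L) (IsCMField.complexConj L) hw)
          (placeForm (Matrix.of fun i j : Fin 2 => if i.val + j.val + 1 = 2 then (1 : L) else 0) w.1)) ×
        ↥(unitaryGroupOfForm (galAdicCompletionMap (L := L) (IsCMField.complexConj L) hw)
          (placeForm (Matrix.of fun i j : Fin 1 => if i.val + j.val + 1 = 1 then (1 : L) else 0) w.1))) := borel _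
  haveI : BorelSpace
      (↥(unitaryGroupOfForm (galAdicCompletionMap (L := L) (IsCMField.complexConj L) hw)
          (placeForm (Matrix.of fun i j : Fin 2 => if i.val + j.val + 1 = 2 then (1 : L) else 0) w.1)) ×
        ↥(unitaryGroupOfForm (galAdicCompletionMap (L := L) (IsCMField.complexConj L) hw)
          (placeForm (Matrix.of fun i j : Fin 1 => if i.val + j.val + 1 = 1 then (1 : L) else 0) w.1))) := ⟨rfl⟩
  obtain ⟨S, hSc, hSsing, hSnull⟩ :=
    exists_closed_null_superset_GSingular (galAdicCompletionMap (L := L) (IsCMField.complexConj L) hw) hσc hσσ ha hε hε0 hσε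
      (formCongr_quasiSplitFrameTwo_eq_diagonal L w.1 hw) (placeForm (Matrix.of fun i j : Fin 1 => if i.val + j.val + 1 = 1 then (1 : L) else 0) w.1)
  set e₂ := localNonsplitEquiv (IsCMField.complexConj L) (Matrix.of fun i j : Fin 2 => if i.val + j.val + 1 = 2 then (1 : L) else 0) hc w hw with he₂
  set e₁ := localNonsplitEquiv (IsCMField.complexConj L) (Matrix.of fun i j : Fin 1 => if i.val + j.val + 1 = 1 then (1 : L) else 0) hc w hw with he₁
  let e : (((cmDatum L 2 (Matrix.of fun i j : Fin 2 => if i.val + j.val + 1 = 2 then (1 : L) else 0)).Local v ×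
      (cmDatum L 1 (Matrix.of fun i j : Fin 1 => if i.val + j.val + 1 = 1 then (1 : L) else 0)).Local v)) ≃ₜ*
      (↥(unitaryGroupOfForm (galAdicCompletionMap (L := L) (IsCMField.complexConj L) hw)
          (placeForm (Matrix.of fun i j : Fin 2 => if i.val + j.val + 1 = 2 then (1 : L) else 0) w.1)) ×
        ↥(unitaryGroupOfForm (galAdicCompletionMap (L := L) (IsCMField.complexConj L) hw)
          (placeForm (Matrix.of fun i j : Fin 1 => if i.val + j.val + 1 = 1 then (1 : L) else 0) w.1))) :=
    { MulEquiv.prodCongr e₂.toMulEquiv e₁.toMulEquiv with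
      continuous_toFun := (e₂.continuous.comp continuous_fst).prodMk (e₁.continuous.comp continuous_snd)
      continuous_invFun := (e₂.symm.continuous.comp continuous_fst).prodMk (e₁.symm.continuous.comp continuous_snd) }
  have he_apply : ∀ s, e s = (e₂ s.1, e₁ s.2) := fun _ => rfl
  haveI : (ν.map e).IsHaarMeasure := ContinuousMulEquiv.isHaarMeasure_map ν e
  have h1 := hSnull (ν.map e) inferInstance
  have hm : Measurable (e : (((cmDatum L 2 (Matrix.of fun i j : Fin 2 => if i.val + j.val + 1 = 2 then (1 : L) else 0)).Local v ×
      (cmDatum L 1 (Matrix.of fun i j : Fin 1 => if i.val + j.val + 1 = 1 then (1 : L) else 0)).Local v)) → _) :=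
    e.continuous.measurable
  rw [Measure.map_apply hm hSc.measurableSet] at h1
  refine measure_mono_null (fun s hs => ?_) h1
  refine hSsing (e s) fun hsep => hs ?_
  -- `IsLocalGRegular s` ↔ the block image `ι_v(s)` is regular ↔ (one-place model at `N = 3`) separable `w`-component, which is `ι((s.1)_w, (s.2)_w)`
  have key : IsLocalGRegular L v s ↔ IsRegularElt ((endoEmbLocal L v s).val : GL (Fin 3) (UnitaryGroup.LocalRing L v)) := Iff.rfl
  rw [key, isRegularElt_iff_charpoly_separable_localNonsplitEquiv (IsCMField.complexConj L) 3
    (Matrix.of fun i j : Fin 3 => if i.val + j.val + 1 = 3 then (1 : L) else 0) hc w hw]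
  have hcoe : ((localNonsplitEquiv (IsCMField.complexConj L)
        (Matrix.of fun i j : Fin 3 => if i.val + j.val + 1 = 3 then (1 : L) else 0) hc w hw (endoEmbLocal L v s) :
        unitaryGroupOfForm (galAdicCompletionMap (L := L) (IsCMField.complexConj L) hw)
          (placeForm (Matrix.of fun i j : Fin 3 => if i.val + j.val + 1 = 3 then (1 : L) else 0) w.1)) :
        GL (Fin 3) (w.1.adicCompletion L)) =
      endoGL (((e₂ s.1 : unitaryGroupOfForm (galAdicCompletionMap (L := L) (IsCMField.complexConj L) hw)
          (placeForm (Matrix.of fun i j : Fin 2 => if i.val + j.val + 1 = 2 then (1 : L) else 0) w.1)) : GL (Fin 2) (w.1.adicCompletion L)),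
        ((e₁ s.2 : unitaryGroupOfForm (galAdicCompletionMap (L := L) (IsCMField.complexConj L) hw)
          (placeForm (Matrix.of fun i j : Fin 1 => if i.val + j.val + 1 = 1 then (1 : L) else 0) w.1)) : GL (Fin 1) (w.1.adicCompletion L))) := by
    have h := map_endoGL (Pi.evalRingHom (fun w' : PlacesOver L v => w'.1.adicCompletion L) w)
      ((s.1.val : GL (Fin 2) (UnitaryGroup.LocalRing L v)), (s.2.val : GL (Fin 1) (UnitaryGroup.LocalRing L v)))
    exact Units.ext (congrArg Units.val h)
  rw [hcoe]
  rw [he_apply] at hsep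
  exact hsep

/-- The same with the organ's first binder `hns : ∀ w ∣ v, c • w = w` (non-split `v`). [cite: Rogawski1990, §4.3 p. 42; §12.5 pp. 182–183] [cite: HarishChandra1970, Lemma 42] -/
theorem measure_setOf_not_isLocalGRegular_local_eq_zero_of_forall (hns : ∀ w : PlacesOver L v, IsCMField.complexConj L • w.1 = w.1)
    [MeasurableSpace (((cmDatum L 2 (Matrix.of fun i j : Fin 2 => if i.val + j.val + 1 = 2 then (1 : L) else 0)).Local v ×
      (cmDatum L 1 (Matrix.of fun i j : Fin 1 => if i.val + j.val + 1 = 1 then (1 : L) else 0)).Local v))]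
    [BorelSpace (((cmDatum L 2 (Matrix.of fun i j : Fin 2 => if i.val + j.val + 1 = 2 then (1 : L) else 0)).Local v ×
      (cmDatum L 1 (Matrix.of fun i j : Fin 1 => if i.val + j.val + 1 = 1 then (1 : L) else 0)).Local v))]
    (ν : Measure (((cmDatum L 2 (Matrix.of fun i j : Fin 2 => if i.val + j.val + 1 = 2 then (1 : L) else 0)).Local v ×
      (cmDatum L 1 (Matrix.of fun i j : Fin 1 => if i.val + j.val + 1 = 1 then (1 : L) else 0)).Local v))) [ν.IsHaarMeasure] :
    ν {s | ¬ IsLocalGRegular L v s} = 0 := by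
  obtain ⟨w⟩ : Nonempty (PlacesOver L v) := inferInstance
  exact measure_setOf_not_isLocalGRegular_local_eq_zero L v w (hns w) ν

/-- **Haar-almost every element of `H_v = U(Φ₂)(L⁺_v) × U(Φ₁)(L⁺_v)` is `G`-regular** (non-split `v`) — the a.e. form the `H_v`-side Weyl integration formula and the
adjoint transfer consume (restricting `∫_{H_v}` to the `G`-regular set). [cite: Rogawski1990, §4.3 p. 42; §12.5 pp. 182–183] [cite: HarishChandra1970, Lemma 42] -/
theorem ae_isLocalGRegular (w : PlacesOver L v) (hw : IsCMField.complexConj L • w.1 = w.1)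
    [MeasurableSpace (((cmDatum L 2 (Matrix.of fun i j : Fin 2 => if i.val + j.val + 1 = 2 then (1 : L) else 0)).Local v ×
      (cmDatum L 1 (Matrix.of fun i j : Fin 1 => if i.val + j.val + 1 = 1 then (1 : L) else 0)).Local v))]
    [BorelSpace (((cmDatum L 2 (Matrix.of fun i j : Fin 2 => if i.val + j.val + 1 = 2 then (1 : L) else 0)).Local v ×
      (cmDatum L 1 (Matrix.of fun i j : Fin 1 => if i.val + j.val + 1 = 1 then (1 : L) else 0)).Local v))]
    (ν : Measure (((cmDatum L 2 (Matrix.of fun i j : Fin 2 => if i.val + j.val + 1 = 2 then (1 : L) else 0)).Local v ×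
      (cmDatum L 1 (Matrix.of fun i j : Fin 1 => if i.val + j.val + 1 = 1 then (1 : L) else 0)).Local v))) [ν.IsHaarMeasure] :
    ∀ᵐ s ∂ν, IsLocalGRegular L v s := by
  rw [ae_iff]
  exact measure_setOf_not_isLocalGRegular_local_eq_zero L v w hw ν

end H

end Summit.HodgeConjecture.HodgeConjecture.Cruxes.H413.F0P3cStCharTSSingularNullH

end
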